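import Mathlib
import HarnessLib
import Literature.MathematicalPhysics.QuantumLattice.SectorisedIncrementBoundGradedWeightedPlateau
import Literature.MathematicalPhysics.QuantumLattice.SectorisedIncrementBoundBinomialWeightedPlateau
import Summits.HubbardSuperconductivity.HubbardSuperconductivity.Theorems.KLProgrammeKLRegimeEngineNormsStepDoor
import Summits.HubbardSuperconductivity.HubbardSuperconductivity.Theorems.KLProgrammeKLRegimeEngineTowerModelDefs

/-!
# Route `KLProgramme` — crux K3 ENGINE (stmt-HubbardSuperconductivity-20437 `KLRegimeEngineV17F2`), stub (b) v2, THE LEVELS PACKAGE (ℓ):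
# instantiation (I1), MODEL HALF, WEIGHTED TRACK — the two weighted (Hstep) doors AT A BLOCK STEP of the scale flow, plateau facts discharged
# (E1-LEVELS-BLUEPRINT-g8 §1 / (I1); E1 lead r2d-p2 g8)

A block step of the blocked tower at the frame `K` integrates the block covariance `Γ := C^K_{(Λ_{J₂}, Λ_{J₁}]} = hubbardCovSliceCT L M β μ 0 K (klScale klE0 J₂)
(klScale klE0 J₁)`, `1 ≤ J₁ ≤ J₂` (block `k ≥ 1`: `J₁ = dk`, `J₂ = d(k+1)`).  The blueprint's FAMILY CONVENTION (§1): the input `G` (= `𝒱_{J₁}[K]`, but ANY even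
`G` without constant part here) is analysed in the thin family `F_{J₁−1} := klAnisoFamily … K klE0 (J₁−1)` with fat partner `F̃_{J₁−1} := bgmFatMultiplier … (J₁−1)`,
and the born increment is read in the thin family `F_{J′}`, `J′ ≥ J₁` (the coarse end `J′ = J₁` is the tower's choice).  This file DISCHARGES the four plateau
hypotheses of the E1 lead's weighted doors (`Literature/…/SectorisedIncrementBoundGradedWeightedPlateau`, `…BinomialWeightedPlateau`) for this geometry:

* §1 block-covariance support: `blockSliceCT_apply_eq_zero_of_le_left/right` (no entry with a leg at `t ≥ Λ_{J₁}`), **`sum_klAnisoFamily_eq_one_of_blockSliceCT_ne_zero`**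
  (`hCpl`: the block covariance lives in the plateau `{t ≤ Λ_{J₁}}` of `F_{J₁−1}`); `hFF` = `bgmFatMultiplier_mul_bgmMultiplier`, `hF0` =
  `klAnisoFamily_eq_zero_of_sum_eq_zero`, `hF'pl` = `sum_klAnisoFamily_eq_one_of_klAnisoFamily_ne_zero` (all [tree]);
* §2 **`blockStep_ordersGe2_wt_le`** — orders ≥ 2 of the block step, weighted pinned sums at `F_{J′}` of `effAction Γ G − e^{Δ_Γ} G`, graded RHS in the weighted
  input sizes `B m′` of `G` at `F_{J₁−1}` — MODULO the named block constants (Gram `κ`, weighted rows/cols `α` of `S(F̃)ᵀΓS(F̃)`, weighted overlap `(cr, cc)` of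
  `E(F_{J′})·S(F̃)`, radius `ρ`, `θ < 1`), exactly the hypotheses p3's Λ-generic `isGramBoundedR_sliceCT_bgmFat` / `rowSum_sliceCT_bgmFat_le` and p4's overlap rows serve;
* §3 **`blockStep_firstOrder_wt_le`** — first order `e^{Δ_Γ} G − G` likewise (binomial RHS).
The tree weight is any `IsTreeWeight wt` with leg map `latticeLegPos (2·(2M))` on both sides (the tower takes `wt := klScaleWt L M β J′`, `isTreeWeight_klScaleWt`).
With `G := klTowerInput … d k` (`𝒱_{dk}`: even by part 15 `klEffectiveAction_mem_evenPart`, no constant part when `Z_{dk} ≠ 0`) and the semigroup identity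
`klEffectiveAction_eq_effAction_slice`, §2 + §3 bound the born sizes `klTowerBornWt … d k` of …TowerModelDefs (blueprint (I1), dimensionless conversion = kit
…TowerScaling).  Compositions of landed theorems; nothing about the model is asserted beyond them; nothing asserts superconductivity.
-/

noncomputable section

namespace Summit.HubbardSuperconductivity.HubbardSuperconductivity.Theorems.EngineV8

set_option linter.dupNamespace false -- summit = problem name (single-conjunct summit), D-0017

open Real Finset Literature.MathematicalPhysics.QuantumLattice Literature.Probability.LatticeModels GrassmannAlgebra
open Summit.HubbardSuperconductivity.HubbardSuperconductivity.Theorems.KLProgrammeLegKernels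
open Summit.HubbardSuperconductivity.HubbardSuperconductivity.Theorems.KLRegimeSplit
open Summit.HubbardSuperconductivity.HubbardSuperconductivity.Theorems.KLRegimeWick
open Summit.HubbardSuperconductivity.HubbardSuperconductivity.Theorems.TwoPointAssembly
open Literature.Probability.LatticeModels.BattleFederbush

variable {L M : ℕ} [NeZero L]

/-! ## §1 The block covariance lives in the plateau of the input family -/

omit [NeZero L] in
/-- **The block covariance `C^K_{(Λ_{J₂}, Λ_{J₁}]}` (`J₁ ≤ J₂`) has no entry whose LEFT leg sits at `t ≥ Λ_{J₁}`.** -/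
theorem blockSliceCT_apply_eq_zero_of_le_left (β μ : ℝ) (K : TrigPolyC4v) {J₁ J₂ : ℕ} (hJ : J₁ ≤ J₂) (X Y : HubbardFieldIdx L M)
    (hX : klScale klE0 J₁ ^ 2 ≤ matsubaraFreq β M X.1.1.1 ^ 2 + nambuXiCT L μ K X.1.1.2 ^ 2) :
    hubbardCovSliceCT L M β μ 0 K (klScale klE0 J₂) (klScale klE0 J₁) X Y = 0 := by
  have hΛ1 : 0 < klScale klE0 J₁ := klth_klScale_pos _
  have hΛ2 : 0 < klScale klE0 J₂ := klth_klScale_pos _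
  have h21 : klScale klE0 J₂ ^ 2 ≤ klScale klE0 J₁ ^ 2 :=
    pow_le_pow_left₀ hΛ2.le (klScale_le_klScale (by norm_num [klE0]) hJ) 2
  have hw1 : hubbardCutoffWeightCT L M β μ K (klScale klE0 J₁) (momentumOf L M X) = 1 :=
    hubbardCutoffWeightCT_eq_one_of_sq_le β μ K hΛ1 _ hX
  have hw2 : hubbardCutoffWeightCT L M β μ K (klScale klE0 J₂) (momentumOf L M X) = 1 :=
    hubbardCutoffWeightCT_eq_one_of_sq_le β μ K hΛ2 _ (h21.trans hX)
  rw [hubbardCovSliceCT, Matrix.sub_apply]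
  by_cases hXY : X.1 = Y.1
  · have hmY : momentumOf L M Y = momentumOf L M X := by simp only [momentumOf]; rw [hXY]
    simp only [hubbardCovAboveCT, Matrix.of_apply, hmY, hw1, hw2]
    norm_num
  · simp only [hubbardCovAboveCT, Matrix.of_apply]
    rw [hubbardCovarianceCT_eq_zero_of_fst_ne β μ K hXY, mul_zero, mul_zero, sub_self]

omit [NeZero L] in
/-- **… and none whose RIGHT leg sits at `t ≥ Λ_{J₁}`.** -/
theorem blockSliceCT_apply_eq_zero_of_le_right (β μ : ℝ) (K : TrigPolyC4v) {J₁ J₂ : ℕ} (hJ : J₁ ≤ J₂) (X Y : HubbardFieldIdx L M)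
    (hY : klScale klE0 J₁ ^ 2 ≤ matsubaraFreq β M Y.1.1.1 ^ 2 + nambuXiCT L μ K Y.1.1.2 ^ 2) :
    hubbardCovSliceCT L M β μ 0 K (klScale klE0 J₂) (klScale klE0 J₁) X Y = 0 := by
  have hΛ1 : 0 < klScale klE0 J₁ := klth_klScale_pos _
  have hΛ2 : 0 < klScale klE0 J₂ := klth_klScale_pos _
  have h21 : klScale klE0 J₂ ^ 2 ≤ klScale klE0 J₁ ^ 2 :=
    pow_le_pow_left₀ hΛ2.le (klScale_le_klScale (by norm_num [klE0]) hJ) 2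
  have hw1 : hubbardCutoffWeightCT L M β μ K (klScale klE0 J₁) (momentumOf L M Y) = 1 :=
    hubbardCutoffWeightCT_eq_one_of_sq_le β μ K hΛ1 _ hY
  have hw2 : hubbardCutoffWeightCT L M β μ K (klScale klE0 J₂) (momentumOf L M Y) = 1 :=
    hubbardCutoffWeightCT_eq_one_of_sq_le β μ K hΛ2 _ (h21.trans hY)
  rw [hubbardCovSliceCT, Matrix.sub_apply]
  by_cases hXY : X.1 = Y.1
  · have hmX : momentumOf L M X = momentumOf L M Y := by simp only [momentumOf]; rw [hXY]
    simp only [hubbardCovAboveCT, Matrix.of_apply, hmX, hw1, hw2]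
    norm_num
  · simp only [hubbardCovAboveCT, Matrix.of_apply]
    rw [hubbardCovarianceCT_eq_zero_of_fst_ne β μ K hXY, mul_zero, mul_zero, sub_self]

omit [NeZero L] in
/-- **`hCpl` for a block step**: an entry of the block covariance `C^K_{(Λ_{J₂}, Λ_{J₁}]}` (`1 ≤ J₁ ≤ J₂`) is nonzero only if both legs lie in the plateau of the
thin family of index `J₁ − 1` (`Σ_ω klAnisoFamily … (J₁−1) ω = 1` there). -/
theorem sum_klAnisoFamily_eq_one_of_blockSliceCT_ne_zero (β μ : ℝ) (K : TrigPolyC4v) {J₁ J₂ : ℕ} (hJ₁ : 1 ≤ J₁) (hJ : J₁ ≤ J₂)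
    (X Y : HubbardFieldIdx L M) (h : hubbardCovSliceCT L M β μ 0 K (klScale klE0 J₂) (klScale klE0 J₁) X Y ≠ 0) :
    ∑ ω, klAnisoFamily L M β μ K klE0 (J₁ - 1) ω X.1.1 = 1 ∧ ∑ ω, klAnisoFamily L M β μ K klE0 (J₁ - 1) ω Y.1.1 = 1 := by
  have hΛ : 0 < klScale klE0 J₁ := klth_klScale_pos _
  have he : (0 : ℝ) < klE0 := by norm_num [klE0]
  have hJ' : J₁ - 1 + 1 = J₁ := Nat.sub_add_cancel hJ₁
  constructor
  · have hX : matsubaraFreq β M X.1.1.1 ^ 2 + nambuXiCT L μ K X.1.1.2 ^ 2 < klScale klE0 J₁ ^ 2 :=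
      lt_of_not_ge fun hge => h (blockSliceCT_apply_eq_zero_of_le_left β μ K hJ X Y hge)
    have h1 := sum_klAnisoFamily_eq_one_of_le β μ K he (J₁ - 1) X.1.1
    rw [hJ'] at h1
    exact h1 ((Real.sqrt_lt' hΛ).2 hX).le
  · have hY : matsubaraFreq β M Y.1.1.1 ^ 2 + nambuXiCT L μ K Y.1.1.2 ^ 2 < klScale klE0 J₁ ^ 2 :=
      lt_of_not_ge fun hge => h (blockSliceCT_apply_eq_zero_of_le_right β μ K hJ X Y hge)
    have h1 := sum_klAnisoFamily_eq_one_of_le β μ K he (J₁ - 1) Y.1.1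
    rw [hJ'] at h1
    exact h1 ((Real.sqrt_lt' hΛ).2 hY).le

omit [NeZero L] in
/-- `hF'pl` for a block step: the output family `F_{J′}`, `J₁ ≤ J′`, lives in the plateau of `F_{J₁−1}` (`1 ≤ J₁`). -/
theorem sum_klAnisoFamily_pred_eq_one_of_klAnisoFamily_ne_zero (β μ : ℝ) (K : TrigPolyC4v) {J₁ J' : ℕ} (hJ₁ : 1 ≤ J₁) (hJ' : J₁ ≤ J')
    (ω' : Fin (sectorCount J')) (p : FreqMomentum L M) (h : klAnisoFamily L M β μ K klE0 J' ω' p ≠ 0) :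
    ∑ ω, klAnisoFamily L M β μ K klE0 (J₁ - 1) ω p = 1 :=
  sum_klAnisoFamily_eq_one_of_klAnisoFamily_ne_zero β μ K (by omega) ω' p h

/-! ## §2 Orders ≥ 2 of a block step, weighted track -/

section Doors

variable [NeZero M] {Λ : Type*} [DecidableEq Λ] {wt : Finset Λ → ℝ}

/-- **ORDERS ≥ 2 OF A BLOCK STEP, WEIGHTED PINNED SUMS (the graded weighted door at the block geometry).**  `1 ≤ J₁ ≤ J₂`, `J₁ ≤ J′`; `F := F_{J₁−1}`,
`F̃ := F̃_{J₁−1}`, `F′ := F_{J′}`, `Γ := C^K_{(Λ_{J₂}, Λ_{J₁}]}`; `G` even without constant part; tree weight `wt` with leg maps `πi, πi″`; block constants as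
hypotheses (`κ`, weighted `α`, weighted `(cr, cc)`, `ρ`, `θ < 1`); weighted input sizes `B m′` of `G` at `F`.  Conclusion: the weighted pinned sums at `F′` of
`effAction Γ G − e^{Δ_Γ} G` in degree `m + 1` are bounded by the door's graded right side. -/
theorem blockStep_ordersGe2_wt_le (hwt : IsTreeWeight wt) {β : ℝ} (hβ : 0 < β) (μ : ℝ) (K : TrigPolyC4v) {J₁ J₂ J' : ℕ}
    (hJ₁ : 1 ≤ J₁) (hJ : J₁ ≤ J₂) (hJ' : J₁ ≤ J')
    (πi : SpaceTimeIdx L M × SectorLeg (sectorCount (J₁ - 1)) → Λ) (πo : SpaceTimeIdx L M × SectorLeg (sectorCount J') → Λ)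
    (G : HubbardGrassmann L M) (hG : G ∈ evenPart ℂ (HubbardFieldIdx L M)) (hG0 : constPart ℂ G = 0)
    {κ : ℝ} (hκ : 0 < κ)
    (hGB : IsGramBoundedR ((sectorSubMatrix L M β (bgmFatMultiplier L M klE0 β (nambuXiCT L μ K) (J₁ - 1))).transpose *
      hubbardCovSliceCT L M β μ 0 K (klScale klE0 J₂) (klScale klE0 J₁) *
        sectorSubMatrix L M β (bgmFatMultiplier L M klE0 β (nambuXiCT L μ K) (J₁ - 1))) κ)
    (B : ℕ → ℝ) (hB0 : ∀ m', 0 ≤ B m')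
    (hB : ∀ (m' : ℕ) (j : Fin (2 * m')) (w : SpaceTimeIdx L M × SectorLeg (sectorCount (J₁ - 1))),
      ∑ Y ∈ univ.filter (fun Y : Fin (2 * m') → SpaceTimeIdx L M × SectorLeg (sectorCount (J₁ - 1)) => Y j = w),
        wt ((univ.image Y).image πi) *
          ‖kernel ℂ (ExteriorAlgebra.map (Matrix.toLin' (sectorAnalysisMatrix L M β (klAnisoFamily L M β μ K klE0 (J₁ - 1)))) G) (2 * m') Y‖ ≤
        B m')
    {α : ℝ} (hα : 0 < α)
    (hrow : ∀ X, ∑ Y, ‖((sectorSubMatrix L M β (bgmFatMultiplier L M klE0 β (nambuXiCT L μ K) (J₁ - 1))).transpose *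
        hubbardCovSliceCT L M β μ 0 K (klScale klE0 J₂) (klScale klE0 J₁) *
          sectorSubMatrix L M β (bgmFatMultiplier L M klE0 β (nambuXiCT L μ K) (J₁ - 1))) X Y‖ * wt {πi X, πi Y} ≤ α)
    (hcol : ∀ Y, ∑ X, ‖((sectorSubMatrix L M β (bgmFatMultiplier L M klE0 β (nambuXiCT L μ K) (J₁ - 1))).transpose *
        hubbardCovSliceCT L M β μ 0 K (klScale klE0 J₂) (klScale klE0 J₁) *
          sectorSubMatrix L M β (bgmFatMultiplier L M klE0 β (nambuXiCT L μ K) (J₁ - 1))) X Y‖ * wt {πi X, πi Y} ≤ α)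
    {ρ : ℝ} (hρ : 0 < ρ)
    (hθ : Real.exp 1 * α * normV (SpaceTimeIdx L M × SectorLeg (sectorCount (J₁ - 1))) κ ρ (fun m' => imagTimeWeight β M ^ (2 * m') * B m') / κ ^ 2 < 1)
    {cr cc : ℝ} (hcc0 : 0 ≤ cc)
    (hrow' : ∀ X'', ∑ X', ‖(sectorAnalysisMatrix L M β (klAnisoFamily L M β μ K klE0 J') *
        sectorSubMatrix L M β (bgmFatMultiplier L M klE0 β (nambuXiCT L μ K) (J₁ - 1))) X'' X'‖ * wt {πo X'', πi X'} ≤ cr)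
    (hcol' : ∀ X', ∑ X'', ‖(sectorAnalysisMatrix L M β (klAnisoFamily L M β μ K klE0 J') *
        sectorSubMatrix L M β (bgmFatMultiplier L M klE0 β (nambuXiCT L μ K) (J₁ - 1))) X'' X'‖ * wt {πo X'', πi X'} ≤ cc)
    {N₀ : ℕ} (hN₀ : 2 ≤ N₀) (m : ℕ) (p : Fin (m + 1)) (w'' : SpaceTimeIdx L M × SectorLeg (sectorCount J')) :
    ∑ X'' ∈ univ.filter (fun X'' : Fin (m + 1) → SpaceTimeIdx L M × SectorLeg (sectorCount J') => X'' p = w''),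
        wt ((univ.image X'').image πo) *
          ‖kernel ℂ (ExteriorAlgebra.map (Matrix.toLin' (sectorAnalysisMatrix L M β (klAnisoFamily L M β μ K klE0 J')))
            (effAction ℂ (hubbardCovSliceCT L M β μ 0 K (klScale klE0 J₂) (klScale klE0 J₁)) G -
              gaussConv ℂ (hubbardCovSliceCT L M β μ 0 K (klScale klE0 J₂) (klScale klE0 J₁)) G)) (m + 1) X''‖ ≤
      cr * cc ^ m *
        (∑ n ∈ Ico 2 N₀, (ρ⁻¹ ^ (m + 1) * κ⁻¹ ^ (2 * (n - 1)) * (α ^ (n - 1) * Real.exp n)) *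
            ∑ δ ∈ (Fintype.piFinset fun _ : Fin n => range (Fintype.card (SpaceTimeIdx L M × SectorLeg (sectorCount (J₁ - 1))) / 2 + 1)) with
                m + 1 + 2 * (n - 1) ≤ ∑ a, 2 * δ a,
              ∏ a, (Real.exp 2 * (κ + ρ)) ^ (2 * δ a) * (imagTimeWeight β M ^ (2 * δ a) * B (δ a)) +
          ρ⁻¹ ^ (m + 1) *
            (Real.exp 1 * normV (SpaceTimeIdx L M × SectorLeg (sectorCount (J₁ - 1))) κ ρ (fun m' => imagTimeWeight β M ^ (2 * m') * B m')) *
            (Real.exp 1 * α * normV (SpaceTimeIdx L M × SectorLeg (sectorCount (J₁ - 1))) κ ρ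
                (fun m' => imagTimeWeight β M ^ (2 * m') * B m') / κ ^ 2) ^ (N₀ - 1) /
            (1 - Real.exp 1 * α * normV (SpaceTimeIdx L M × SectorLeg (sectorCount (J₁ - 1))) κ ρ
                (fun m' => imagTimeWeight β M ^ (2 * m') * B m') / κ ^ 2)) := by
  have he : (0 : ℝ) < klE0 := by norm_num [klE0]
  exact sum_wt_norm_sectorAnalysis_effAction_sub_gaussConv_le_graded_of_plateau hwt πi πo hβ
    (klAnisoFamily L M β μ K klE0 (J₁ - 1)) (bgmFatMultiplier L M klE0 β (nambuXiCT L μ K) (J₁ - 1))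
    (fun ω k => bgmFatMultiplier_mul_bgmMultiplier he β (nambuXiCT L μ K) (J₁ - 1) ω k)
    (fun k hk ω => klAnisoFamily_eq_zero_of_sum_eq_zero β μ K klE0 (J₁ - 1) k hk ω)
    (klAnisoFamily L M β μ K klE0 J') G hG hG0 _
    (fun X Y hXY => sum_klAnisoFamily_eq_one_of_blockSliceCT_ne_zero β μ K hJ₁ hJ X Y hXY)
    (fun ω' k hne => sum_klAnisoFamily_pred_eq_one_of_klAnisoFamily_ne_zero β μ K hJ₁ hJ' ω' k hne)
    hκ hGB B hB0 hB hα hrow hcol hρ hθ hcc0 hrow' hcol' hN₀ m p w''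

/-! ## §3 First order of a block step, weighted track -/

/-- **FIRST ORDER OF A BLOCK STEP, WEIGHTED PINNED SUMS (the binomial weighted door at the block geometry).**  Same geometry and constants (no `α`, `ρ`,
`θ` needed); even `G`; degree `2(p+1)` output: the weighted pinned sums at `F′` of `e^{Δ_Γ} G − G` are bounded by the binomial right side in the weighted input
sizes `B m′` of `G` at `F`. -/
theorem blockStep_firstOrder_wt_le (hwt : IsTreeWeight wt) {β : ℝ} (hβ : 0 < β) (μ : ℝ) (K : TrigPolyC4v) {J₁ J₂ J' : ℕ}
    (hJ₁ : 1 ≤ J₁) (hJ : J₁ ≤ J₂) (hJ' : J₁ ≤ J')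
    (πi : SpaceTimeIdx L M × SectorLeg (sectorCount (J₁ - 1)) → Λ) (πo : SpaceTimeIdx L M × SectorLeg (sectorCount J') → Λ)
    (G : HubbardGrassmann L M) (hG : G ∈ evenPart ℂ (HubbardFieldIdx L M))
    {κ : ℝ} (hκ : 0 ≤ κ)
    (hGB : IsGramBoundedR ((sectorSubMatrix L M β (bgmFatMultiplier L M klE0 β (nambuXiCT L μ K) (J₁ - 1))).transpose *
      hubbardCovSliceCT L M β μ 0 K (klScale klE0 J₂) (klScale klE0 J₁) *
        sectorSubMatrix L M β (bgmFatMultiplier L M klE0 β (nambuXiCT L μ K) (J₁ - 1))) κ)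
    (B : ℕ → ℝ) (hB0 : ∀ m', 0 ≤ B m')
    (hB : ∀ (m' : ℕ) (j : Fin (2 * m')) (w : SpaceTimeIdx L M × SectorLeg (sectorCount (J₁ - 1))),
      ∑ Y ∈ univ.filter (fun Y : Fin (2 * m') → SpaceTimeIdx L M × SectorLeg (sectorCount (J₁ - 1)) => Y j = w),
        wt ((univ.image Y).image πi) *
          ‖kernel ℂ (ExteriorAlgebra.map (Matrix.toLin' (sectorAnalysisMatrix L M β (klAnisoFamily L M β μ K klE0 (J₁ - 1)))) G) (2 * m') Y‖ ≤
        B m')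
    {cr cc : ℝ} (hcc0 : 0 ≤ cc)
    (hrow' : ∀ X'', ∑ X', ‖(sectorAnalysisMatrix L M β (klAnisoFamily L M β μ K klE0 J') *
        sectorSubMatrix L M β (bgmFatMultiplier L M klE0 β (nambuXiCT L μ K) (J₁ - 1))) X'' X'‖ * wt {πo X'', πi X'} ≤ cr)
    (hcol' : ∀ X', ∑ X'', ‖(sectorAnalysisMatrix L M β (klAnisoFamily L M β μ K klE0 J') *
        sectorSubMatrix L M β (bgmFatMultiplier L M klE0 β (nambuXiCT L μ K) (J₁ - 1))) X'' X'‖ * wt {πo X'', πi X'} ≤ cc)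
    (p : ℕ) (q : Fin (2 * (p + 1))) (w'' : SpaceTimeIdx L M × SectorLeg (sectorCount J')) :
    ∑ X'' ∈ univ.filter (fun X'' : Fin (2 * (p + 1)) → SpaceTimeIdx L M × SectorLeg (sectorCount J') => X'' q = w''),
        wt ((univ.image X'').image πo) *
          ‖kernel ℂ (ExteriorAlgebra.map (Matrix.toLin' (sectorAnalysisMatrix L M β (klAnisoFamily L M β μ K klE0 J')))
            (gaussConv ℂ (hubbardCovSliceCT L M β μ 0 K (klScale klE0 J₂) (klScale klE0 J₁)) G - G)) (2 * (p + 1)) X''‖ ≤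
      cr * cc ^ (2 * p + 1) *
        ∑ m' ∈ range (Fintype.card (SpaceTimeIdx L M × SectorLeg (sectorCount (J₁ - 1))) / 2 + 1),
          (if p + 1 < m' then ((2 * m').choose (2 * (p + 1)) : ℝ) * κ ^ (2 * m' - 2 * (p + 1)) *
            (imagTimeWeight β M ^ (2 * m') * B m') else 0) := by
  have he : (0 : ℝ) < klE0 := by norm_num [klE0]
  exact sum_wt_norm_sectorAnalysis_gaussConv_sub_le_binomial_of_plateau hwt πi πo hβ
    (klAnisoFamily L M β μ K klE0 (J₁ - 1)) (bgmFatMultiplier L M klE0 β (nambuXiCT L μ K) (J₁ - 1))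
    (fun ω k => bgmFatMultiplier_mul_bgmMultiplier he β (nambuXiCT L μ K) (J₁ - 1) ω k)
    (fun k hk ω => klAnisoFamily_eq_zero_of_sum_eq_zero β μ K klE0 (J₁ - 1) k hk ω)
    (klAnisoFamily L M β μ K klE0 J') G hG _
    (fun X Y hXY => sum_klAnisoFamily_eq_one_of_blockSliceCT_ne_zero β μ K hJ₁ hJ X Y hXY)
    (fun ω' k hne => sum_klAnisoFamily_pred_eq_one_of_klAnisoFamily_ne_zero β μ K hJ₁ hJ' ω' k hne)
    hκ hGB B hB0 hB hcc0 hrow' hcol' p q w''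

end Doors

end Summit.HubbardSuperconductivity.HubbardSuperconductivity.Theorems.EngineV8

end
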